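import Literature.Probability.LatticeModels.CircleWeightBondModel
import Literature.Probability.LatticeModels.VillainCurrentModel
import Literature.Probability.LatticeModels.VillainGriffithsFirst
import HarnessLib

/-!
# The worm representation on the space-time torus:
# `⟨cos(θ_{(x,0)} − θ_{(y,0)})⟩_{v_β} = G(x, y)` for the Villain rotator on `JCurrent.bondSystem d L M`

Fourier duality between the Villain plane rotator `∏_{(s,μ)} v_β(θ_{s+e_μ} − θ_s) dθ` on the bond system
of the space-time torus `(ℤ/Lℤ)^d × ℤ/Mℤ` (`JCurrent.bondSystem`, Haar probability measure `dθ` on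
`U(1)^{sites}`, `CircleWeightBondModel.lean`) and the homogeneous Villain integer-current model
`PositiveCurrentModel.villain (fun _ => β)` of `PositiveCurrentModel.lean` (Wallin et al. 1994 §II;
Fröhlich–Spencer 1982 §2): PROVED,

* `JCurrent.integral_coe_diffChar_mul_pairWeight_villain` —
  `∫ θ̄_X θ_Y ∏_b v_β(arg χ_b(θ)) dθ = (2πβ)^{-|bonds|/2} · Z(δ_Y − δ_X)` (character expansion
  `integral_coe_char_mul_prod_tsum` with the Poisson form `hasSum_villainKernel_fourier_circle`; the
  triviality of the twisted character is Kirchhoff's law `div n = δ_Y − δ_X`,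
  `twistChar_pinned_eq_one_iff` + `JCurrent.sum_bond_incidence_mul`);
* `JCurrent.pairExpect_cosDiff_villain_eq_twoPoint` — the ratio:
  `⟨cos(θ_{(x,0)} − θ_{(y,0)})⟩_{v_β,1} = (villain β).twoPoint L M x y = Z(δ_{(x,0)} − δ_{(y,0)})/Z(0)`;
* `VillainCurrentModel.twoPoint_homogeneous_eq_ofReal_pairExpect` — the same for the `ℝ≥0∞`-valued
  `VillainCurrentModel.homogeneous (fun _ => β)` of route BECVortexSheetPeierls.

Theorems only.

## References

* M. Wallin, E. Sørensen, S. Girvin, A. P. Young, Phys. Rev. B 49 (1994) 12115, §II. [WallinEtAl1994]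
* J. Fröhlich, T. Spencer, Comm. Math. Phys. 83 (1982) 411–454, §2.1 (i), §2.2 (2.3), §2.3.
  [FrohlichSpencerCMP1982]
-/

noncomputable section

open MeasureTheory Filter Finset Complex
open scoped BigOperators ComplexConjugate Real

namespace Literature.Probability.LatticeModels

open Literature.MathematicalPhysics.QuantumFieldTheory PositiveCurrentModel

/-! ### Unpinned relative-angle characters and Kirchhoff's law -/

section Kirchhoff

variable {V ι : Type*} [Fintype V] [Fintype ι] [DecidableEq V]

/-- **Triviality of the twisted character = Kirchhoff's law**, unpinned form: for a bond system `G`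
on `V`, sites `X, Y` and a current `n ∈ ℤ^ι`, the character `θ ↦ θ̄_X θ_Y ∏_a (θ̄_{src a} θ_{tgt a})^{n_a}`
is trivial iff at every vertex `v`: `[Y = v] − [X = v] + ∑_a ([tgt a = v] − [src a = v]) n_a = 0`
(the free-vertex case of `twistChar_pinned_eq_one_iff`). [folklore] -/
theorem BondSystem.twistChar_bondChar_diffChar_eq_one_iff (G : BondSystem V ι) (X Y : V) (n : ι → ℤ) :
    twistChar (fun a => G.bondChar a) (diffChar X Y) n = 1 ↔
      ∀ v : V, ((if Y = v then (1 : ℤ) else 0) - (if X = v then 1 else 0)) +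
        ∑ a, ((if G.tgt a = v then (1 : ℤ) else 0) - (if G.src a = v then 1 else 0)) * n a = 0 := by
  -- extension of a torus point to `Option V` by `1` at `none`
  obtain ⟨ext, hext⟩ : ∃ ext : (V → Circle) → Option V → Circle, ∀ u o, ext u o = o.elim 1 u :=
    ⟨_, fun _ _ => rfl⟩
  have hext_one : ∀ o, ext 1 o = 1 := fun o => by rw [hext]; cases o <;> rfl
  have hext_mul : ∀ u u' o, ext (u * u') o = ext u o * ext u' o := fun u u' o => by
    simp only [hext]; cases o <;> simp
  have hext_cont : ∀ o : Option V, Continuous fun u : V → Circle => ext u o := by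
    intro o
    rw [show (fun u : V → Circle => ext u o) = fun u => o.elim 1 u from funext fun u => hext u o]
    cases o with
    | none => exact continuous_const
    | some v => exact continuous_apply v
  have mkChar : ∀ o o' : Option V, ∃ χ : (V → Circle) →ₜ* Circle, ∀ u, χ u = ext u o / ext u o' := by
    intro o o'
    refine ⟨{ toFun := fun u => ext u o / ext u o'
              map_one' := by simp only [hext_one, div_one]
              map_mul' := fun u u' => by simp only [hext_mul]; exact mul_div_mul_comm _ _ _ _
              continuous_toFun := (hext_cont o).div' (hext_cont o') }, fun u => rfl⟩
  choose χf hχf using mkChar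
  have hχf' : ∀ o o' u, χf o o' u = o.elim 1 u / o'.elim 1 u := fun o o' u => by
    rw [hχf, hext, hext]
  have hsome : ∀ p q : V, χf (some q) (some p) = diffChar p q := by
    intro p q
    refine ContinuousMonoidHom.ext fun u => ?_
    rw [hχf', diffChar_apply, div_eq_mul_inv, mul_comm]
    rfl
  have h := twistChar_pinned_eq_one_iff χf hχf' (fun a => some (G.src a)) (fun a => some (G.tgt a))
    (some Y) (some X) n
  simp only [hsome, Option.some.injEq] at h
  exact h

end Kirchhoff

namespace JCurrent

variable {d L M : ℕ}

/-- **Bond incidences on the torus sum to minus the divergence**: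
`∑_b ([tgt b = v] − [src b = v]) n_b = −(div n)(v)` for the bonds `(s, μ) : s → s + e_μ`. [folklore] -/
theorem sum_bond_incidence_mul [NeZero L] [NeZero M] (n : Config d L M) (v : SpaceTimeSite d L M) :
    ∑ b : Bond d L M, ((if (bondSystem d L M).tgt b = v then (1 : ℤ) else 0) -
        (if (bondSystem d L M).src b = v then 1 else 0)) * n b = -div n v := by
  classical
  have hsrc : ∀ b : Bond d L M, (bondSystem d L M).src b = b.1 := fun _ => rfl
  have htgt : ∀ b : Bond d L M, (bondSystem d L M).tgt b = b.1 + unitVec b.2 := fun _ => rfl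
  simp only [hsrc, htgt, sub_mul, Finset.sum_sub_distrib, ite_mul, one_mul, zero_mul, div]
  have h1 : (∑ b : Bond d L M, if b.1 + unitVec b.2 = v then n b else 0) = ∑ μ : Dir d, n (v - unitVec μ, μ) := by
    rw [show (∑ b : Bond d L M, if b.1 + unitVec b.2 = v then n b else 0) =
        ∑ s : SpaceTimeSite d L M, ∑ μ : Dir d, (if s + unitVec μ = v then n (s, μ) else 0) from
      Fintype.sum_prod_type _, Finset.sum_comm]
    refine Finset.sum_congr rfl fun μ _ => ?_
    have : ∀ s : SpaceTimeSite d L M, (s + unitVec μ = v) = (s = v - unitVec μ) := fun s => by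
      rw [eq_sub_iff_add_eq]
    simp only [this, Finset.sum_ite_eq', Finset.mem_univ, if_true]
  have h2 : (∑ b : Bond d L M, if b.1 = v then n b else 0) = ∑ μ : Dir d, n (v, μ) := by
    rw [show (∑ b : Bond d L M, if b.1 = v then n b else 0) =
        ∑ s : SpaceTimeSite d L M, ∑ μ : Dir d, (if s = v then n (s, μ) else 0) from
      Fintype.sum_prod_type _, Finset.sum_comm]
    refine Finset.sum_congr rfl fun μ _ => ?_
    simp only [Finset.sum_ite_eq', Finset.mem_univ, if_true]
  rw [h1, h2, ← Finset.sum_sub_distrib, ← Finset.sum_sub_distrib, ← Finset.sum_neg_distrib]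
  refine Finset.sum_congr rfl fun μ _ => ?_
  ring

variable [NeZero L] [NeZero M] [MeasurableSpace Circle] [BorelSpace Circle] {β : ℝ}

/-- **The character expansion of the Villain rotator on the torus bond system** (`β > 0`):
`∫ θ̄_X θ_Y ∏_b v_β(arg χ_b θ) dθ = (2πβ)^{-|bonds|/2} · Z(δ_Y − δ_X)`, where
`Z(ρ) = ∑_{n : div n = ρ} ∏_b e^{-n_b²/(2β)}` is the current sum of `PositiveCurrentModel.villain`.
[cite: FrohlichSpencerCMP1982, §2.1 (i), §2.2 (2.3), §2.3 (duality transformation)] -/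
theorem integral_coe_diffChar_mul_pairWeight_villain (hβ : 0 < β) (X Y : SpaceTimeSite d L M) :
    ∫ θ, ((diffChar X Y θ : Circle) : ℂ) *
        ((bondSystem d L M).pairWeight (villainCircleWeight β) 1 θ : ℂ) ∂torusHaar (SpaceTimeSite d L M) =
      (((1 / Real.sqrt (2 * π * β)) ^ Fintype.card (Bond d L M) *
        (villain (fun _ => β) (fun _ => hβ)).currentSum (Pi.single Y 1 - Pi.single X 1 :
          SpaceTimeSite d L M → ℤ) : ℝ) : ℂ) := by
  classical
  set G := bondSystem d L M with hG
  set c : Bond d L M → ℤ → ℂ := fun _ m =>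
    ((Real.exp (-((m : ℝ) ^ 2) / (2 * β)) / Real.sqrt (2 * π * β) : ℝ) : ℂ) with hcdef
  have hc : ∀ b, Summable fun m => ‖c b m‖ := fun _ => summable_norm_villainFourierTerm hβ
  -- the weight is the product of the character series
  have hW : ∀ θ : SpaceTimeSite d L M → Circle, (G.pairWeight (villainCircleWeight β) 1 θ : ℂ) =
      ∏ b, ∑' m : ℤ, c b m * ((G.bondChar b θ : Circle) : ℂ) ^ m := fun θ => by
    rw [BondSystem.pairWeight, ofReal_prod]
    refine Finset.prod_congr rfl fun b _ => ?_
    rw [← G.bondChar_apply]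
    exact ((hasSum_villainKernel_fourier_circle hβ (G.bondChar b θ)).tsum_eq).symm
  simp_rw [hW]
  rw [integral_coe_char_mul_prod_tsum (torusHaar _) (fun b => G.bondChar b) (diffChar X Y) hc]
  -- the Kirchhoff condition is `div n = δ_Y − δ_X`
  have hiff : ∀ n : Config d L M, twistChar (fun b => G.bondChar b) (diffChar X Y) n = 1 ↔
      div n = (Pi.single Y 1 - Pi.single X 1 : SpaceTimeSite d L M → ℤ) := by
    intro n
    rw [G.twistChar_bondChar_diffChar_eq_one_iff X Y n, funext_iff]
    refine forall_congr' fun v => ?_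
    rw [sum_bond_incidence_mul, Pi.sub_apply, Pi.single_apply, Pi.single_apply, eq_comm]
    constructor
    · intro h
      have h' : div n v = (if Y = v then (1 : ℤ) else 0) - (if X = v then 1 else 0) := by linarith
      rw [h']
      congr 1 <;> exact if_congr eq_comm rfl rfl
    · intro h
      rw [h]
      have e1 : (if v = Y then (1 : ℤ) else 0) = (if Y = v then 1 else 0) := if_congr eq_comm rfl rfl
      have e2 : (if v = X then (1 : ℤ) else 0) = (if X = v then 1 else 0) := if_congr eq_comm rfl rfl
      rw [e1, e2]; ring
  -- the terms
  have hterm : ∀ n : Config d L M, (if twistChar (fun b => G.bondChar b) (diffChar X Y) n = 1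
      then ∏ b, c b (n b) else 0) =
      (((1 / Real.sqrt (2 * π * β)) ^ Fintype.card (Bond d L M) *
        (if div n = (Pi.single Y 1 - Pi.single X 1 : SpaceTimeSite d L M → ℤ)
          then (villain (fun _ => β) (fun _ => hβ)).bondWeight n else 0) : ℝ) : ℂ) := by
    intro n
    by_cases h : div n = (Pi.single Y 1 - Pi.single X 1 : SpaceTimeSite d L M → ℤ)
    · rw [if_pos ((hiff n).2 h), if_pos h, hcdef]
      dsimp only
      rw [← ofReal_prod, bondWeight, Finset.prod_div_distrib, Finset.prod_const, Finset.card_univ]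
      simp only [villain_weight]
      push_cast
      ring
    · rw [if_neg (fun h' => h ((hiff n).1 h')), if_neg h, mul_zero, ofReal_zero]
  simp_rw [hterm]
  rw [← ofReal_tsum, PositiveCurrentModel.currentSum, ← tsum_mul_left]

/-- `∫ ∏_b v_β(arg χ_b θ) dθ = (2πβ)^{-|bonds|/2} · Z(0)` (the case `X = Y`). [folklore] -/
theorem pairPartitionFn_villain (hβ : 0 < β) :
    (bondSystem d L M).pairPartitionFn (villainCircleWeight β) 1 =
      (1 / Real.sqrt (2 * π * β)) ^ Fintype.card (Bond d L M) *
        (villain (fun _ : Dir d => β) (fun _ => hβ)).partitionFunction L M := by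
  classical
  have h := integral_coe_diffChar_mul_pairWeight_villain (d := d) (L := L) (M := M) hβ (0, 0) (0, 0)
  simp only [diffChar_apply, inv_mul_cancel, Circle.coe_one, one_mul, sub_self, integral_complex_ofReal,
    ofReal_inj] at h
  rw [BondSystem.pairPartitionFn, h, PositiveCurrentModel.partitionFunction]

/-- **The worm representation on the torus**: for the Villain rotator `∏_{(s,μ)} v_β(θ_{s+e_μ} − θ_s) dθ`
on the bond system of `(ℤ/Lℤ)^d × ℤ/Mℤ` (`β > 0`) and spatial sites `x, y`,
`⟨cos(θ_{(x,0)} − θ_{(y,0)})⟩_{v_β,1} = G_{L,M}(x, y) = Z(δ_{(x,0)} − δ_{(y,0)})/Z(0)`, the equal-time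
two-point function of the integer-current model `PositiveCurrentModel.villain (fun _ => β)`.
[cite: WallinEtAl1994, §II] -/
theorem pairExpect_cosDiff_villain_eq_twoPoint (hβ : 0 < β) (x y : TorusSite d L) :
    (bondSystem d L M).pairExpect (villainCircleWeight β) 1
        (cosDiff ((x, 0) : SpaceTimeSite d L M) ((y, 0) : SpaceTimeSite d L M)) =
      (villain (fun _ => β) (fun _ => hβ)).twoPoint L M x y := by
  classical
  set G := bondSystem d L M with hG
  set W := villainCircleWeight β
  have hWc : Continuous W := continuous_villainCircleWeight hβ
  set X : SpaceTimeSite d L M := (x, 0)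
  set Y : SpaceTimeSite d L M := (y, 0)
  -- numerator: real part of the complex character integral
  have hint : Integrable (fun θ => ((diffChar X Y θ : Circle) : ℂ) * (G.pairWeight W 1 θ : ℂ))
      (torusHaar (SpaceTimeSite d L M)) :=
    integrable_torusHaar_of_continuous ((continuous_subtype_val.comp (map_continuous (diffChar X Y))).mul
      (continuous_ofReal.comp (G.continuous_pairWeight hWc 1)))
  have hnum : ∫ θ, cosDiff X Y θ * G.pairWeight W 1 θ ∂torusHaar (SpaceTimeSite d L M) =
      (1 / Real.sqrt (2 * π * β)) ^ Fintype.card (Bond d L M) *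
        (villain (fun _ => β) (fun _ => hβ)).currentSum (Pi.single Y 1 - Pi.single X 1 :
          SpaceTimeSite d L M → ℤ) := by
    have h2 := integral_re hint
    simp only [RCLike.re_to_complex] at h2
    have h1 : ∫ θ, cosDiff X Y θ * G.pairWeight W 1 θ ∂torusHaar (SpaceTimeSite d L M) =
        ∫ θ, (((diffChar X Y θ : Circle) : ℂ) * (G.pairWeight W 1 θ : ℂ)).re ∂torusHaar (SpaceTimeSite d L M) :=
      integral_congr_ae (ae_of_all _ fun θ => by
        dsimp only
        rw [Complex.re_mul_ofReal, cosDiff_eq_reChar]; rfl)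
    rw [h1, h2, integral_coe_diffChar_mul_pairWeight_villain hβ X Y, ofReal_re]
  have hsrc : (Pi.single Y 1 - Pi.single X 1 : SpaceTimeSite d L M → ℤ) = wormSource y x := rfl
  rw [BondSystem.pairExpect, hnum, pairPartitionFn_villain hβ, PositiveCurrentModel.twoPoint, hsrc,
    wormSource_swap, PositiveCurrentModel.currentSum_neg,
    mul_div_mul_left _ _ (pow_ne_zero _ (by positivity))]

end JCurrent

namespace VillainCurrentModel

variable {d L M : ℕ} [NeZero L] [NeZero M] [MeasurableSpace Circle] [BorelSpace Circle]

/-- **The route's two-point function as a rotator correlation**: for the homogeneous isotropic Villain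
current model `homogeneous (fun _ => β)` of route BECVortexSheetPeierls (`β > 0`) and spatial sites
`x, y`, `G((x,0),(y,0)) = ofReal ⟨cos(θ_{(x,0)} − θ_{(y,0)})⟩_{v_β,1}` (worm representation +
`twoPoint_homogeneous`). [cite: WallinEtAl1994, §II] -/
theorem twoPoint_homogeneous_eq_ofReal_pairExpect {β : ℝ} (hβ : 0 < β) (x y : TorusSite d L) :
    (homogeneous (fun _ => β) (fun _ => hβ) : VillainCurrentModel d L M).twoPoint (x, 0) (y, 0) =
      ENNReal.ofReal ((JCurrent.bondSystem d L M).pairExpect (villainCircleWeight β) 1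
        (cosDiff ((x, 0) : JCurrent.SpaceTimeSite d L M) ((y, 0) : JCurrent.SpaceTimeSite d L M))) := by
  rw [twoPoint_homogeneous, JCurrent.pairExpect_cosDiff_villain_eq_twoPoint hβ]

end VillainCurrentModel

end Literature.Probability.LatticeModels
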